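import Summits.CriticalPhenomena.PercolationContinuityZ3.Theorems.Transplant.SkelNegBParamsFaceA
import Summits.CriticalPhenomena.PercolationContinuityZ3.Theorems.Transplant.SkelPhiFaceSlots2
import Summits.CriticalPhenomena.PercolationContinuityZ3.Theorems.Transplant.SkelNegBParamsSlots
import HarnessLib

/-!
# N1 params, (ζ′) chain (`A := NegB.Aof κ = 800·Kq`), part FaceRoomsA: THE (F) WRAPPER'S LEVEL / FRAME-ROOM / COUNT / FACE-APRON BINDERS SERVED AT THE
# (ζ′) RECORD — p1-g13's provider file for hp-8 g36's layer (b) `NegB.faceOblRM_negBTB2` (lead g8 05:47:38Z / 06:04:41Z: one writer per file; these are the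
# discharges p1 dev-checked inside `faceOblRM_negBTA₂`, 06:03–06:06Z, restated as named lemmas)
Binder ↦ lemma (keystone names of `faceOblRM_negBTA₁` :57–:170): `hRlev/hRlev'` ↦ **`hRlev_RA`** (`Rlev := KS.RlevA mk`); `hnC/hU3` ↦ **`nFc_RA`**
(`nFc I := (c_I·|A|·|lv_I(bOf I)|).toNat`); `hroomF/haw` with `aw du := (awF₂ (prFA) fcellsA du).toNat`, `kF := kFF₂ (prFA) fcellsA Rlev` ↦ **`awF₂_nonneg_A`,
`hroomF_RA`, `haw_RA`** (FaceSlots2's `hroomF_kFF₂/haw_awF₂` + `awF₂ ≥ 0`); `hk₀` (k₀ := 3) ↦ FaceLatA `rdN_le_three_rdKA` + `eleven_le_s_TA`, `hk₀'` ↦ `hk₀'_RA`,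
`hkF` ↦ FaceA `hkF_RA` (with **`RlevA_le_RA'`**); `hcount/hN/hk` (`N := KS.NkA`, `M := KS.j₀A − 1`, `kk := KS.kkA`, accuracy `κ.δ₂`) ↦ **`counts_face_T`**;
`hMtan/hMd/hMD/hE` of the face apron `KS.apron … A r₀` (any `A r₀`; `M := j₀A − 1`, `E := RlevA + reachA`) ↦ **`faceApron_rooms_T`**.  All cell-free
except through `prFA/fcellsA`; nothing of record is edited.
builds on p205010 (kernel theorem, internal audit signed; external expert review pending) — nothing here uses p205010; NOTHING is claimed about the node
`SamePDropOfSkeletonNeg₁` (OPEN; closure of record = the L pair; (F) chain re-versioning to v7, hp-8 g36).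
Lane `prim-bschramm-*`, seat `prim-bschramm-p1` (gen 13); helper file (`--supports stmt-CriticalPhenomena-4575 --as helper`).
[cite: KozmaNitzan2024, §4 Lemma 12 (pp. 23–25)] [cite: MartineauTassion2017, §3.2 Lemma 3.5, §4.3 Lemma 4.2]
-/

noncomputable section

open scoped Classical

namespace Summit.CriticalPhenomena.PercolationContinuityZ3.Theorems.Transplant

namespace PlanarSkeletonNeg

namespace NegB

open Literature.Probability.Percolation Literature.Probability.LatticeModels SimpleGraph
open Literature.Probability.Percolation.KozmaNitzan.Cells (oth)
open SkelConc (Consts)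
open SkelI (tanOff)
open Skelφ (shellD)
open Skelφ.StepI (DataN)
open Neg

/-! ## §1 Levels vs cells, the count unit, the frame rooms (at `g := KS.gT mk gx`) -/

section Rooms

variable (κ : Consts) {V : Type} [DecidableEq V] [Countable V] {G : SimpleGraph V} [G.LocallyFinite] (Φ : PlanarSkeletonNeg G) (t : V)
  (p : unitInterval) (D : DataN V) (f mk : ℕ) (gx : Neg.FSlot)

omit [DecidableEq V] in
/-- `RlevA ≤ RA′` (`RA′ = RlevA + 1`) — the `hRl` of FaceA's `hkF_RA` at `Rl := RlevA`. [folklore] -/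
theorem RlevA_le_RA' : KS.RlevA κ Φ t p D mk ≤ KS.RA' κ Φ t p D mk := by
  rw [← (KS.RA'_eq κ Φ t p D mk).2.1]; exact Nat.le_succ _

/-- **Levels vs the (ζ′) cells** at `g := gT`: `RlevA + 4 ≤ 10·s_i` and `RlevA + 4 ≤ 3·r_i` (hp-8's `hRlev/hRlev'`; `s_i ≥ 6RA′+11`, `RA′ = RlevA + 1`,
`r_i = K·s_i`, `K ≥ 40`). [folklore] -/
theorem hRlev_RA (hN : EqNumL κ Φ t p D (KS.gT mk gx κ Φ t p D) f) (hκ : (hL κ Φ t p D (KS.gT mk gx κ Φ t p D) f).natAbs ≤ 10 * nL κ Φ t p D (KS.gT mk gx κ Φ t p D) f)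
    (i : Fin 2) :
    KS.RlevA κ Φ t p D mk + 4 ≤ 10 * (fcellsA κ Φ t p D (KS.gT mk gx κ Φ t p D) f).s i ∧ KS.RlevA κ Φ t p D mk + 4 ≤ 3 * (fcellsA κ Φ t p D (KS.gT mk gx κ Φ t p D) f).r i := by
  obtain ⟨h0, h1⟩ := KS.cells_geTA' κ Φ t p D mk gx f hN hκ
  have hR := (KS.RA'_eq κ Φ t p D mk).2.1
  have hr := (fcellsA_K κ Φ t p D (KS.gT mk gx κ Φ t p D) f).2.2 i
  have hK := (Neg.forty_le_K κ).1
  have hs : KS.RA' κ Φ t p D mk + 3 ≤ (fcellsA κ Φ t p D (KS.gT mk gx κ Φ t p D) f).s i := by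
    obtain rfl | rfl : i = 0 ∨ i = 1 := by fin_cases i <;> simp
    · have : ((KS.RA' κ Φ t p D mk : ℕ) : ℤ) + 3 ≤ (((fcellsA κ Φ t p D (KS.gT mk gx κ Φ t p D) f).s 0 : ℕ) : ℤ) := by linarith
      exact_mod_cast this
    · have : ((KS.RA' κ Φ t p D mk : ℕ) : ℤ) + 3 ≤ (((fcellsA κ Φ t p D (KS.gT mk gx κ Φ t p D) f).s 1 : ℕ) : ℤ) := by linarith
      exact_mod_cast this
  constructor
  · omega
  · rw [hr]; nlinarith

/-- **The face count unit** `nFc I := c_I·|A|·|lv_I(bOf I)|` at the (ζ′) record: nonnegative and `D_A ≤ 3·nFc I` (hp-8's `hnC/hU3`; from `11·D_A < 13·c_I·L_I ≤ 26·A·rdK_I`).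
[folklore] -/
theorem nFc_RA (hN : EqNumL κ Φ t p D (KS.gT mk gx κ Φ t p D) f) (hκ : (hL κ Φ t p D (KS.gT mk gx κ Φ t p D) f).natAbs ≤ 10 * nL κ Φ t p D (KS.gT mk gx κ Φ t p D) f)
    (I : Fin 2) :
    0 ≤ (prFA κ Φ t p D (KS.gT mk gx κ Φ t p D) f).cOf I * |(prFA κ Φ t p D (KS.gT mk gx κ Φ t p D) f).A| *
        |(prFA κ Φ t p D (KS.gT mk gx κ Φ t p D) f).lvGen I ((prFA κ Φ t p D (KS.gT mk gx κ Φ t p D) f).bOf I)| ∧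
      (prFA κ Φ t p D (KS.gT mk gx κ Φ t p D) f).D ≤ 3 * ((prFA κ Φ t p D (KS.gT mk gx κ Φ t p D) f).cOf I * |(prFA κ Φ t p D (KS.gT mk gx κ Φ t p D) f).A| *
        |(prFA κ Φ t p D (KS.gT mk gx κ Φ t p D) f).lvGen I ((prFA κ Φ t p D (KS.gT mk gx κ Φ t p D) f).bOf I)|) := by
  set pr := prFA κ Φ t p D (KS.gT mk gx κ Φ t p D) f
  have hs := eleven_le_s_TA κ Φ t p D f mk gx hN hκ I
  have h1 := cL_lowerA κ Φ t p D (KS.gT mk gx κ Φ t p D) f hN I hs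
  have h2 := rdK_lowerA κ Φ t p D (KS.gT mk gx κ Φ t p D) f I
  have hA : pr.A = Aof κ := (prFA_fields κ Φ t p D (KS.gT mk gx κ Φ t p D) f).1
  have hA0 : 0 < Aof κ := (Aof_pos κ).1
  have hc : 0 ≤ pr.cOf I := (pr.cOf_pos (prFA_c_pos κ Φ t p D _ f).1 (prFA_c_pos κ Φ t p D _ f).2 I).le
  have e : pr.cOf I * |pr.A| * |pr.lvGen I (pr.bOf I)| = Aof κ * pr.rdK I (pr.bOf I) := by
    unfold Skelφ.FinePrm.rdK; rw [hA, abs_of_pos hA0]; ring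
  rw [e]
  have hK0 : 0 ≤ pr.rdK I (pr.bOf I) := by unfold Skelφ.FinePrm.rdK; exact mul_nonneg hc (abs_nonneg _)
  constructor
  · exact mul_nonneg hA0.le hK0
  · nlinarith

end Rooms

section Frame

variable (κ : Consts) {V : Type} [DecidableEq V] [Countable V] {G : SimpleGraph V} [G.LocallyFinite] (Φ : PlanarSkeletonNeg G) (t : V)
  (p : unitInterval) (D : DataN V) (g f : ℕ)

/-- `0 < D_A` at the (ζ′) record under the numeric long clause. [folklore] -/
theorem prFA_D_pos (hN : EqNumL κ Φ t p D g f) : 0 < (prFA κ Φ t p D g f).D := by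
  obtain ⟨hn1, hℓ1⟩ := one_le_of_eqNumL κ Φ t p D g f hN
  rw [(prFA_fields κ Φ t p D g f).2.2.2.2.2.2.2]; exact Skelφ.NegPrm.DofA_pos (Aof_pos κ).2 hn1 hℓ1 _ _

/-- `0 ≤ awF₂ (prFA) fcellsA du` (the ceiling of a nonnegative numerator by `Mabs > 0`). [folklore] -/
theorem awF₂_nonneg_A (hN : EqNumL κ Φ t p D g f) (du : MDir) : 0 ≤ (prFA κ Φ t p D g f).awF₂ (fcellsA κ Φ t p D g f) du := by
  set pr := prFA κ Φ t p D g f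
  set P := fcellsA κ Φ t p D g f
  obtain ⟨hc₀, hc₁⟩ := prFA_c_pos κ Φ t p D g f
  have hDd := prFA_D κ Φ t p D g f
  have hDpos := prFA_D_pos κ Φ t p D g f hN
  have hM := pr.Mabs_pos hc₀ hc₁ hDd hDpos
  have hfe : ∀ i : Fin 2, 0 ≤ P.faceExt du i := fun i => by unfold PCells2.faceExt; split_ifs <;> positivity
  have hrd : ∀ I b, 0 ≤ pr.rdK I b := fun I b => by
    unfold Skelφ.FinePrm.rdK; exact mul_nonneg (pr.cOf_pos hc₀ hc₁ I).le (abs_nonneg _)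
  unfold Skelφ.FinePrm.awF₂ Skelφ.FinePrm.awNum
  apply Int.ediv_nonneg _ hM.le
  have h1 := hrd 1 (pr.bOf du.1); have h0 := hrd 0 (pr.bOf du.1); have e0 := hfe 0; have e1 := hfe 1
  have : 0 ≤ (pr.rdK 1 (pr.bOf du.1) * (P.faceExt du 0 + 1) + pr.rdK 0 (pr.bOf du.1) * (P.faceExt du 1 + 1)) * pr.D := by positivity
  linarith

/-- **`hroomF` at the (ζ′) record** with `aw du := (awF₂ du).toNat`, `kF := kFF₂ Rlev` (FaceSlots2 `hroomF_kFF₂`). [cite: KozmaNitzan2024, §4 Lemma 12 (pp. 23–25)] -/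
theorem hroomF_RA (hN : EqNumL κ Φ t p D g f) (Rlev : ℕ) (du : MDir) :
    (prFA κ Φ t p D g f).Mabs * (((((prFA κ Φ t p D g f).awF₂ (fcellsA κ Φ t p D g f) du).toNat : ℕ) : ℤ) + (Rlev : ℤ) + 1) +
        (prFA κ Φ t p D g f).rdN du.1 ((prFA κ Φ t p D g f).bOf du.1) * ((Rlev : ℤ) + 2) * (prFA κ Φ t p D g f).D ≤
      (prFA κ Φ t p D g f).rdK du.1 ((prFA κ Φ t p D g f).bOf du.1) * (prFA κ Φ t p D g f).kFF₂ (fcellsA κ Φ t p D g f) Rlev du.1 * (prFA κ Φ t p D g f).D := by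
  obtain ⟨hc₀, hc₁⟩ := prFA_c_pos κ Φ t p D g f
  rw [Int.toNat_of_nonneg (awF₂_nonneg_A κ Φ t p D g f hN du)]
  exact (prFA κ Φ t p D g f).hroomF_kFF₂ hc₀ hc₁ (prFA_D κ Φ t p D g f) (prFA_D_pos κ Φ t p D g f hN) (fcellsA κ Φ t p D g f) Rlev du

/-- **`haw` at the (ζ′) record** with `aw du := (awF₂ du).toNat` (FaceSlots2 `haw_awF₂`). [cite: KozmaNitzan2024, §4 Lemma 12 (pp. 23–25)] -/
theorem haw_RA (hN : EqNumL κ Φ t p D g f) (du : MDir) :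
    ((prFA κ Φ t p D g f).rdK 1 ((prFA κ Φ t p D g f).bOf du.1) * ((fcellsA κ Φ t p D g f).faceExt du 0 + 1) +
          (prFA κ Φ t p D g f).rdK 0 ((prFA κ Φ t p D g f).bOf du.1) * ((fcellsA κ Φ t p D g f).faceExt du 1 + 1)) * (prFA κ Φ t p D g f).D ≤
      (prFA κ Φ t p D g f).Mabs * (((((prFA κ Φ t p D g f).awF₂ (fcellsA κ Φ t p D g f) du).toNat : ℕ) : ℤ) + 1) := by
  obtain ⟨hc₀, hc₁⟩ := prFA_c_pos κ Φ t p D g f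
  rw [Int.toNat_of_nonneg (awF₂_nonneg_A κ Φ t p D g f hN du)]
  exact (prFA κ Φ t p D g f).haw_awF₂ hc₀ hc₁ (prFA_D κ Φ t p D g f) (prFA_D_pos κ Φ t p D g f hN) (fcellsA κ Φ t p D g f) du

end Frame

/-! ## §2 The face kit's counts at `κ.δ₂` and the face apron's rooms (cell-free) -/

section Kit

variable (κ : Consts) {V : Type} [DecidableEq V] [Countable V] {G : SimpleGraph V} [G.LocallyFinite] (Φ : PlanarSkeletonNeg G) (t : V)
  (p : unitInterval) (D : DataN V) (mk : ℕ)

/-- **The face kit's counts at accuracy `κ.δ₂`** (`N := KS.NkA`, `kk := KS.kkA`, levels `Icc ((j₀A − 1) + 1) RlevA ⊇ Icc j₀A j₁A`): hp-8's `hN`, `hk`, `hcount`.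
[folklore] -/
theorem counts_face_T (hp0 : 0 < (p : ℝ)) (hp1 : (p : ℝ) < 1) {q : unitInterval} (hq1 : (p : ℝ) / 2 ≤ q) (hq2 : (q : ℝ) ≤ p) :
    KS.kkA κ Φ t p D mk * (Φ.Δ + 1) ^ (2 * KS.rsA Φ t D mk) ≤ KS.NkA κ Φ t p D mk ∧
      (1 - (q : ℝ) ^ (1 + Φ.Δ * KS.cSA Φ t D mk + KS.cSA Φ t D mk * KS.cUA Φ t D mk)) ^ KS.kkA κ Φ t p D mk ≤ κ.δ₂ ∧
      1 / (1 - (q : ℝ)) ^ (Φ.Δ * KS.NkA κ Φ t p D mk) ≤ κ.δ₂ * ((Finset.Icc ((KS.j₀A t D mk - 1) + 1) (KS.RlevA κ Φ t p D mk)).card : ℝ) := by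
  obtain ⟨hk, hc⟩ := KS.counts_R κ Φ t p D mk hp0 hp1 hq1 hq2 (Neg.δkit_le_δ₂ κ Φ)
  refine ⟨KS.hNk_at κ Φ t p D mk hp0 hp1, hk, hc.trans (mul_le_mul_of_nonneg_left ?_ κ.hδ₂0.le)⟩
  have hsub : Finset.Icc (KS.j₀A t D mk) (KS.j₁A κ Φ t p D mk) ⊆ Finset.Icc ((KS.j₀A t D mk - 1) + 1) (KS.RlevA κ Φ t p D mk) :=
    Finset.Icc_subset_Icc (by have := (KS.le_T₀a t D mk).2.2; unfold KS.j₀A; omega) (KS.RA'_eq κ Φ t p D mk).2.2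
  exact_mod_cast Finset.card_le_card hsub

omit [DecidableEq V] in
/-- **The face apron's rooms** for `KS.apron … A r₀` (any `A`, `r₀`) at `M := j₀A − 1`, `E := RlevA + reachA`: hp-8's `hMtan`, `hMd`, `hMD`, `hE`
(`tanOff = T₀a = j₀A`, `levels_wide` at `j₀A`, `reachA = 13·(T₀a+1) + 13·da + KCmax`). [folklore] -/
theorem faceApron_rooms_T (A : ℤ) (r₀ : ℕ) :
    tanOff (KS.apron Φ t D mk A r₀).ℓs (KS.apron Φ t D mk A r₀).M ≤ ((KS.j₀A t D mk - 1 : ℕ) : ℤ) + 1 ∧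
      (KS.apron Φ t D mk A r₀).d + 2 ≤ 2 * (KS.j₀A t D mk - 1) + 2 ∧
      shellD (KS.apron Φ t D mk A r₀) + 1 + (KS.apron Φ t D mk A r₀).d + KS.KCmax t D mk + KS.Rs t D mk ≤ 2 * (KS.j₀A t D mk - 1) + 2 ∧
      KS.RlevA κ Φ t p D mk + ((KS.apron Φ t D mk A r₀).N * (tanOff (KS.apron Φ t D mk A r₀).ℓs (KS.apron Φ t D mk A r₀).M + 1) +
          (KS.apron Φ t D mk A r₀).N * (KS.apron Φ t D mk A r₀).d + KS.KCmax t D mk) ≤ KS.RlevA κ Φ t p D mk + KS.reachA t D mk := by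
  have h1 := (KS.le_T₀a t D mk).2.2
  have hw := KS.levels_wide t D mk (le_refl (KS.j₀A t D mk))
  have hF := KS.apron_fields Φ t D mk A r₀
  rw [KS.tanOff_apron, KS.shellD_apron, hF.1, hF.2.2.2.1]
  unfold KS.j₀A at *
  refine ⟨by omega, by omega, by omega, ?_⟩
  unfold KS.reachA; omega

end Kit

end NegB

end PlanarSkeletonNeg

end Summit.CriticalPhenomena.PercolationContinuityZ3.Theorems.Transplant

end
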